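import Summits.QuantumFields.YangMills.Theorems.BalabanUVNodesK0Stub1FlatChartDImplicit
import Summits.QuantumFields.YangMills.Theorems.BalabanUVNodesK0Stub1FlatChartTheta0AtRecord
import Summits.QuantumFields.YangMills.Theorems.BalabanUVNodesK0Stub1TransposesByDualiser
import HarnessLib

/-!
# K0⁷ STUB 1 (`stub_prop8StepCoP13`), sub-target S4b ♭ road — **(β2): THE IMPLICIT DIFFERENTIATION OF (49)♭ AT THE K0 CARRIER** — for the implicit ♭ chart `Dsel♭` (FILE α,
# `K0Stub1FlatChartDImplicit`): `D(Dsel♭)(A′) = C♭′_Φ ∘ (1 − H♭∘D(Dsel♭)(A′))`, `Φ = A′ − H♭(Dsel♭A′)` (print (66)–(68)), a transpose `Ct` of `C♭′_Φ := D(C♭)(Φ)` WITH ITS COLUMN LETTER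
# `w₃(b)‖Ct X b‖ ≤ (2Θ₀)·r·‖X‖_∞` read off k0-s1-w2's p628026 AT THE DRESSED POINT, and the transposed-`H♭` letter `h₀` for EVERY transpose of `H♭` (p620776) — i.e. EXACTLY the
# `himp` and `hH` binders of k0-s1-w2's Neumann socket `K0Stub1TransposeNeumannLetter.h73t_of_implicit_transposes` ((β1)) at `Dfun := Dsel♭`, generic carrier and the record's tori

Cell `pub-ymgap`, width seat `pub-ymgap-k0-s1-w4` g2 (CLAIM-3 ∕ INTENT-3, bus 2026-08-28T11:32Z; (β) SPLIT with k0-s1-w2 g5 I.36827: (β1) abstract Neumann socket theirs, (β2) this).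
`--kind proof --supports stmt-QuantumFields-20541 --as helper`; count-neutral.  [15] = [Balaban1985Variational]; [B7] = [Balaban1985Averaging].

WHY.  k0-s1-w2's Sect. F W-slot Socket (p621022) builds `Dt A′` — a transpose of `fderiv Dfun A′` — and displays its column letter `h73t`.  For the chart's `Dfun := Dsel♭` (the
(49)♭ fixed point, LOCATED-♭-IMPLICIT-CHART) print differentiates (49): «𝔇 = C′(1 − H𝔇)» ((66)–(68) p.288) and sums a Neumann series ((69)–(73)).  The series is (β1)'s abstract
socket; THIS FILE supplies its inputs at the K0 carrier: the implicit relation (UST `Chart47Analytic` §3 — `hasFDerivAt_chart47W_of_size_le`, `eventually_fix_of_size_le`,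
`differentiableAt_shift_of_size_le` — + chain rule + uniqueness of the Fréchet derivative), a transpose `Ct` of `C♭′_Φ` by formula (p606823 `exists_capstoneTransposes`) with its
letter from p628026 `h73t_flat_P` AT THE DRESSED POINT `Φ` (both sizes of `Φ` are `≤ 2r` by the sharp (55)♭ and `9C₂♭B₀ε < 1`), and at the record the `h₀` letter of EVERY transpose of
the ♭-kernel `H` (p620776 `h46t_unitWeight_of_adm22_T4` through the uniqueness `adjointHt_apply_eq_kernel`).

WHAT IS PROVED (sorry-free; no definition; axioms standard; fibre `M_N(ℂ)`, `N ≥ 1`).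
* §1 (generic `P`, `4 ≤ d`) ★★★ `himp_chartDFlat_P` — data: nested `D` (`D.k = k`), `Adm22 D R′ M` (`2L ≤ R′`, `1 ≤ M`), (152) weights, fibre letters, (27)∕block pairings, a ℂ-linear
  `H` with both (46) rows `B₀` (`‖·‖_∞` currency), a map `Dsel` with FILE α's spec on the `w₁`-ball of radius `ε` (sharp (55)♭ `4C₂♭ρ²`, (49)♭), FILE α's window and p627481's four
  windows at radius `2ε`.  CONCLUSION ((β1)'s `himp` at `wB′ ≡ 1`, `θC := 2Θ₀`, `Θ₀ = (|η|ᵈ)⁻¹M_ρΘ♭·4dη⁴`): for sizes `≤ r < ε` of `A′`,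
  `∃ C′ Ct, (∀ δ, fderiv ℂ Dsel A′ δ = C′ (δ − H (fderiv ℂ Dsel A′ δ))) ∧ (∀ X δ, BE (Ct X) δ = B X (C′ δ)) ∧ ∀ X s, (∀ t, 1·‖X t‖ ≤ s) → ∀ b, w₃(b)‖Ct X b‖ ≤ (2Θ₀)·r·s`.
* The record editions (`hHt_flat_T4` = (β1)'s `hH` for every transpose of the ♭-kernel `H`; `exists_chartDFlat_himp_T4` = the implicit ♭ chart with `himp` and all its other
  letters at NODE 00's tori) are the sequel file `…K0Stub1FlatChartDTransposeLetterAtRecord` (400-line cap).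
HONEST SCOPE.  Chain rule + bookkeeping over landed letters BY NAME (p628026's (157)♭-fed letter, p620776, p621874, p606823, UST `Chart47Analytic`); the abstract Neumann step is
(β1)'s (k0-s1-w2), NOT here; nothing of [15]∕[B7] asserted beyond the engines; `stub_prop8StepCoP13` ∕ K0⁷ NOT closed; N07 NOT discharged; no summit statement is proved by
this seat; counts unmoved (28∕28 · 5∕27); one finite 𝕋⁴ programme at fixed ε — R4 closes the conditional finite-𝕋⁴ rung `BalabanLadder.UV` only, never the summit; the YM mass
gap (Clay) is NOT proved by any of this; nothing continuum ∕ ℝ⁴ ∕ OS.  No `sorry`, no `def`, no `instance`, no `notation`.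

References: [15] (27) p.282, (44)–(50) p.285, (55)–(57) p.286, (63)–(73) pp.287–289, (88)–(90) pp.291–292, Prop. 4 (98) p.293, (157) p.302; [B7] Prop. 5 (157) p.42;
[Balaban1987RG1] (0.1) p.251.
-/

set_option autoImplicit false

noncomputable section

open scoped BigOperators Matrix.Norms.L2Operator Topology ContDiff
open NormedSpace Metric Set Filter

namespace Summit.QuantumFields.YangMills.Theorems.K0Stub1FlatChartDTransposeLetter

open Literature.MathematicalPhysics.QuantumFieldTheory.Balaban1983to89

/-! ## §1  Generic carrier: the implicit relation, a transpose of `C♭′_Φ` and its letter at the dressed point ((β1)'s `himp`) -/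

section Generic

open B6SectADomainsV1 (Domains)
open B6SectAOperatorsV1 (BondIdx)
open B9Eq39Adjoint (bondPair)
open Summit.QuantumFields.YangMills.Theorems.FlatCubeOpsText (Adm22)
open Summit.QuantumFields.YangMills.Theorems.K0FlatCubeOpsTextP (IsLevWeight)
open Summit.QuantumFields.YangMills.Theorems.Prop8ChartDoubleBar (chartLogFlat)
open Summit.QuantumFields.YangMills.Theorems.Chart47Analytic (hasFDerivAt_chart47W_of_size_le eventually_fix_of_size_le differentiableAt_shift_of_size_le)
open Summit.QuantumFields.YangMills.Theorems.K0Stub1FlatChartRemainderP (chartRemainderFlat_hCd_hCq)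
open Summit.QuantumFields.YangMills.Theorems.K0Stub1FlatChartTheta0AtRecord (h73t_flat_P)
open Summit.QuantumFields.YangMills.Theorems.K0Stub1SectFWSlotAtRecordFlatChart (nonempty_bondIdx)
open Summit.QuantumFields.YangMills.Theorems.K0Stub1TransposesByDualiser (exists_capstoneTransposes)
open Summit.QuantumFields.YangMills.Theorems.K0Stub1PairingsAtExtensions (bondPair_PBond_eq_sum)

variable {P : Params} {N : ℕ}

/-- ★★★ **(β1)'s `himp` FOR THE IMPLICIT ♭ CHART, GENERIC CARRIER** (`4 ≤ d`, fibre `M_N(ℂ)`, `N ≥ 1`).  Data: a nested family `D` (`D.k = k`) admissible `Adm22 D R′ M` with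
`2L ≤ R′`, `1 ≤ M`; the (152) weights; the fibre letters; the (27) pairing `BE = bondPair η d τ` (`η = L^{−k}`) and the block pairing `B`; a ℂ-linear `H` with BOTH (46)
rows `B₀` in the `‖·‖_∞` currency; a map `Dsel` with the sharp (55)♭ and (49)♭ on the `w₁`-ball of radius `ε` (FILE α's `exists_analytic_chartDFlat` ∕ `flatChartDSocket`).
Windows (all k-free): α's `9C₂♭B₀ε < 1`, `3ε ≤ R⋆♭∕4`; p627481's four windows at radius `2ε`.  THEN for sizes `≤ r < ε` of `A′`:
**`∃ C′ Ct, (∀ δ, D(Dsel)(A′)δ = C′(δ − H(D(Dsel)(A′)δ))) ∧ (Ct transposes C′) ∧ (∀ X s, (∀ t, 1·‖X t‖ ≤ s) → ∀ b, w₃(b)‖Ct X b‖ ≤ (2Θ₀)·r·s)`**, `Θ₀ = (|η|ᵈ)⁻¹M_ρΘ♭·4dη⁴`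
(p628026's constant) — (β1)'s `himp` binder at `Dfun := Dsel♭`, `wB′ ≡ 1`, `θC := 2Θ₀`.  Proof: `C′ := D(C♭)(Φ)`, `Φ = A′ − H(Dsel A′)` (both sizes `≤ 2r`); implicit
differentiation of (49)♭ (UST `Chart47Analytic` §3 + chain rule + `HasFDerivAt.unique`); `Ct` by formula (p606823); its letter = p628026 at `Φ` with `r ↦ 2r`.
[cite: Balaban1985Variational, (27) p.282, (47)-(50) p.285, (55)-(57) p.286, (63)-(73) pp.287-289, (88)-(90) pp.291-292, Prop. 4 (98) p.293, (157) p.302; Balaban1985Averaging, Prop. 5 (157) p.42] -/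
theorem himp_chartDFlat_P [NeZero N] [DecidableEq (PBond P 0)] (hd : 4 ≤ P.d) (k : ℕ) (D : Domains P) (hDk : D.k = k)
    {R' Mb : ℕ} (hAdm : Adm22 D R' Mb) (hR'L : 2 * P.L ≤ R') (hMb : 1 ≤ Mb)
    {w : ℕ → PBond P 0 → ℝ} (hw : IsLevWeight P k D w)
    (τ : Matrix (Fin N) (Fin N) ℂ →L[ℂ] ℂ) (ρ : (Matrix (Fin N) (Fin N) ℂ →L[ℂ] ℂ) →L[ℂ] Matrix (Fin N) (Fin N) ℂ)
    (hρ : ∀ (ℓ' : Matrix (Fin N) (Fin N) ℂ →L[ℂ] ℂ) (X : Matrix (Fin N) (Fin N) ℂ), τ (ρ ℓ' * X) = ℓ' X)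
    (hτ : ∀ a b : Matrix (Fin N) (Fin N) ℂ, τ (a * b) = τ (b * a)) (hτ1 : ∀ X : Matrix (Fin N) (Fin N) ℂ, ‖τ X‖ ≤ ‖X‖)
    {Mρ : ℝ} (hMρ : 0 ≤ Mρ) (hρn : ∀ ℓ' : Matrix (Fin N) (Fin N) ℂ →L[ℂ] ℂ, ‖ρ ℓ'‖ ≤ Mρ * ‖ℓ'‖)
    (BE : (PBond P 0 → Matrix (Fin N) (Fin N) ℂ) →L[ℂ] (PBond P 0 → Matrix (Fin N) (Fin N) ℂ) →L[ℂ] ℂ)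
    (hBE : ∀ Y δ : PBond P 0 → Matrix (Fin N) (Fin N) ℂ, BE Y δ = bondPair (((P.L : ℝ)⁻¹) ^ k) P.d (τ : Matrix (Fin N) (Fin N) ℂ →ₗ[ℂ] ℂ) (fun μ x => Y ⟨x, μ⟩) (fun μ x => δ ⟨x, μ⟩))
    (B : (BondIdx D → Matrix (Fin N) (Fin N) ℂ) →L[ℂ] (BondIdx D → Matrix (Fin N) (Fin N) ℂ) →L[ℂ] ℂ)
    (hB : ∀ X X' : BondIdx D → Matrix (Fin N) (Fin N) ℂ, B X X' = ∑ t, τ (X t * X' t))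
    (H : (BondIdx D → Matrix (Fin N) (Fin N) ℂ) →ₗ[ℂ] (PBond P 0 → Matrix (Fin N) (Fin N) ℂ)) {B₀ : ℝ} (hB₀ : 0 ≤ B₀)
    (hHB : ∀ (X : BondIdx D → Matrix (Fin N) (Fin N) ℂ) (t : ℝ), 0 ≤ t → (∀ c, ‖X c‖ ≤ t) → ∀ b, w 1 b * ‖H X b‖ ≤ B₀ * t)
    (hHgrad : ∀ (X : BondIdx D → Matrix (Fin N) (Fin N) ℂ) (t : ℝ), 0 ≤ t → (∀ c, ‖X c‖ ≤ t) →
      ∀ (b : PBond P 0) (ν : Fin P.d), w 2 b * (P.L : ℝ) ^ k * ‖H X ⟨b.src.shift ν, b.dir⟩ - H X b‖ ≤ B₀ * t)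
    (Dsel : (PBond P 0 → Matrix (Fin N) (Fin N) ℂ) → (BondIdx D → Matrix (Fin N) (Fin N) ℂ)) {ε : ℝ} (hε : 0 < ε)
    (hq : 9 * (64 * (P.L : ℝ) / (60800 * (((P.d + 2) * P.L : ℕ) : ℝ) ^ 2 * (P.L : ℝ))⁻¹) * B₀ * ε < 1)
    (h3ε : 3 * ε ≤ (60800 * (((P.d + 2) * P.L : ℕ) : ℝ) ^ 2 * (P.L : ℝ))⁻¹ / 4)
    (hDsharp : ∀ A' : PBond P 0 → Matrix (Fin N) (Fin N) ℂ, (∀ b, w 1 b * ‖A' b‖ < ε) →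
      ∀ ρ' : ℝ, 0 ≤ ρ' → (∀ b, w 1 b * ‖A' b‖ ≤ ρ') →
        ∀ i : BondIdx D, ‖Dsel A' i‖ ≤ (4 * (64 * (P.L : ℝ) / (60800 * (((P.d + 2) * P.L : ℕ) : ℝ) ^ 2 * (P.L : ℝ))⁻¹)) * ρ' ^ 2)
    (hDfix : ∀ A' : PBond P 0 → Matrix (Fin N) (Fin N) ℂ, (∀ b, w 1 b * ‖A' b‖ < ε) →
      chartLogFlat (((P.L : ℝ)⁻¹) ^ k) D (A' - H (Dsel A')) -
          (fderiv ℂ (chartLogFlat (((P.L : ℝ)⁻¹) ^ k) D : (PBond P 0 → Matrix (Fin N) (Fin N) ℂ) → BondIdx D → Matrix (Fin N) (Fin N) ℂ) 0) (A' - H (Dsel A'))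
        = Dsel A')
    -- p627481's four windows at the radius `2ε` of the dressed point
    (hwin1 : 121600 * (((P.d + 2) * P.L : ℕ) : ℝ) ^ 2 * (P.L : ℝ) * (2 * ε) ≤ 1)
    (hwin2 : 51200 * (((P.d + 2) * P.L : ℕ) : ℝ) * (P.L : ℝ) * (2 * ε) ≤ 1)
    (hwin3 : (2560 * (((P.d + 2) * P.L : ℕ) : ℝ) / (400 * (((P.d + 2) * P.L : ℕ) : ℝ))⁻¹) * (2 * (P.d : ℝ)) /
        ((P.L : ℝ) ^ 2 * ((P.L : ℝ) ^ P.d)⁻¹) * (16 * ((P.L : ℝ) * (2 * ε))) ≤ 1 / 12)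
    (hwin4 : (P.L : ℝ) * (2 * ε) ≤ 1 / 20) :
    ∀ (A' : PBond P 0 → Matrix (Fin N) (Fin N) ℂ) (r : ℝ), (∀ b, w 1 b * ‖A' b‖ ≤ r) →
      (∀ (b : PBond P 0) (ν : Fin P.d), w 2 b * (P.L : ℝ) ^ k * ‖A' ⟨b.src.shift ν, b.dir⟩ - A' b‖ ≤ r) → r < ε →
      ∃ (C' : (PBond P 0 → Matrix (Fin N) (Fin N) ℂ) →L[ℂ] (BondIdx D → Matrix (Fin N) (Fin N) ℂ))
        (Ct : (BondIdx D → Matrix (Fin N) (Fin N) ℂ) →L[ℂ] (PBond P 0 → Matrix (Fin N) (Fin N) ℂ)),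
        (∀ δ, fderiv ℂ Dsel A' δ = C' (δ - H (fderiv ℂ Dsel A' δ))) ∧
        (∀ X δ, BE (Ct X) δ = B X (C' δ)) ∧
        ∀ (X : BondIdx D → Matrix (Fin N) (Fin N) ℂ) (s : ℝ), (∀ t, (1 : ℝ) * ‖X t‖ ≤ s) →
          ∀ b, w 3 b * ‖Ct X b‖ ≤
            (2 * (((|((P.L : ℝ)⁻¹) ^ k| ^ P.d)⁻¹ * Mρ *
              (16 * ((2560 * (((P.d + 2) * P.L : ℕ) : ℝ) / (400 * (((P.d + 2) * P.L : ℕ) : ℝ))⁻¹) * (2 * (P.d : ℝ)) /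
                ((P.L : ℝ) ^ 2 * ((P.L : ℝ) ^ P.d)⁻¹)) * (P.L : ℝ) / (1 - 2 / (P.L : ℝ) - 1 / 12)) *
              (4 * (P.d : ℝ) * (((P.L : ℝ)⁻¹) ^ k) ^ 4)))) * r * s := by
  classical
  -- abbreviations
  set Rs : ℝ := (60800 * (((P.d + 2) * P.L : ℕ) : ℝ) ^ 2 * (P.L : ℝ))⁻¹ with hRs
  set C₂ : ℝ := 64 * (P.L : ℝ) / Rs with hC₂
  set Θ₀ : ℝ := ((|((P.L : ℝ)⁻¹) ^ k| ^ P.d)⁻¹ * Mρ *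
      (16 * ((2560 * (((P.d + 2) * P.L : ℕ) : ℝ) / (400 * (((P.d + 2) * P.L : ℕ) : ℝ))⁻¹) * (2 * (P.d : ℝ)) /
        ((P.L : ℝ) ^ 2 * ((P.L : ℝ) ^ P.d)⁻¹)) * (P.L : ℝ) / (1 - 2 / (P.L : ℝ) - 1 / 12)) *
      (4 * (P.d : ℝ) * (((P.L : ℝ)⁻¹) ^ k) ^ 4)) with hΘ₀
  set η : ℝ := ((P.L : ℝ)⁻¹) ^ k with hη
  haveI : Nonempty (BondIdx D) := nonempty_bondIdx D (by omega)
  intro A' r h0 h1 hr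
  have hL3 : 3 ≤ P.L := by obtain ⟨⟨k', hk'⟩, h1'⟩ := P.hL; omega
  have hL3r : (3 : ℝ) ≤ P.L := by exact_mod_cast hL3
  have hL0 : (0 : ℝ) < P.L := by linarith
  have hℓ1 : (1 : ℝ) ≤ (((P.d + 2) * P.L : ℕ) : ℝ) := by
    exact_mod_cast Nat.one_le_iff_ne_zero.mpr (Nat.mul_ne_zero (by omega) (by have := P.hL.2; omega))
  have hden : 0 < 60800 * (((P.d + 2) * P.L : ℕ) : ℝ) ^ 2 * (P.L : ℝ) := by positivity
  have hRs0 : 0 < Rs := inv_pos.mpr hden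
  have hC₂0 : 0 ≤ C₂ := div_nonneg (by positivity) hRs0.le
  have hη0 : 0 < η := by positivity
  have hw1pos : ∀ b : PBond P 0, 0 < w 1 b := fun b => by rw [hw 1 b, pow_one]; positivity
  have hw2nn : ∀ b : PBond P 0, 0 ≤ w 2 b := fun b => by rw [hw 2 b]; positivity
  have hw3nn : ∀ b : PBond P 0, 0 ≤ w 3 b := fun b => by rw [hw 3 b]; positivity
  have hdenΘ : 0 < 1 - 2 / (P.L : ℝ) - 1 / 12 := by
    have : 2 / (P.L : ℝ) ≤ 2 / 3 := div_le_div_of_nonneg_left (by norm_num) (by norm_num) hL3r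
    linarith
  have hΘ₀0 : 0 ≤ Θ₀ := by
    rw [hΘ₀]
    apply mul_nonneg (mul_nonneg (by positivity) (div_nonneg (by positivity) hdenΘ.le)) (by positivity)
  -- `0 ≤ r`
  let b₀ : PBond P 0 := ⟨fun _ => 0, ⟨0, P.hd⟩⟩
  have hr0 : 0 ≤ r := le_trans (mul_nonneg (hw1pos b₀).le (norm_nonneg _)) (h0 b₀)
  have hA'ε : ∀ b', w 1 b' * ‖A' b'‖ < ε := fun b' => (h0 b').trans_lt hr
  -- the continuous-linear copy of `H` and the maps of the chart
  let Hc : (BondIdx D → Matrix (Fin N) (Fin N) ℂ) →L[ℂ] (PBond P 0 → Matrix (Fin N) (Fin N) ℂ) := LinearMap.toContinuousLinearMap H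
  have hHc : ∀ X, Hc X = H X := fun _ => rfl
  set Qlin : (PBond P 0 → Matrix (Fin N) (Fin N) ℂ) →L[ℂ] (BondIdx D → Matrix (Fin N) (Fin N) ℂ) :=
    fderiv ℂ (chartLogFlat η D : (PBond P 0 → Matrix (Fin N) (Fin N) ℂ) → BondIdx D → Matrix (Fin N) (Fin N) ℂ) 0 with hQlin
  set C : (PBond P 0 → Matrix (Fin N) (Fin N) ℂ) → (BondIdx D → Matrix (Fin N) (Fin N) ℂ) := fun A => chartLogFlat η D A - Qlin A with hCdef
  -- the chart data of UST `Chart47Analytic` at the K0 carrier (as in FILE α)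
  have hRM : 2 * P.L ≤ R' * Mb + 1 := by have : R' ≤ R' * Mb := Nat.le_mul_of_pos_right R' hMb; omega
  obtain ⟨hdiff, hquad⟩ := chartRemainderFlat_hCd_hCq (𝔸 := Matrix (Fin N) (Fin N) ℂ) k hR'L hMb D hDk hAdm hw
  have hCq : ∀ (Y : PBond P 0 → Matrix (Fin N) (Fin N) ℂ) (r' : ℝ), r' < Rs / 4 → (∀ b', w 1 b' * ‖Y b'‖ ≤ r') →
      ∀ c : BondIdx D, (fun _ : BondIdx D => (1 : ℝ)) c * ‖C Y c‖ ≤ C₂ * r' ^ 2 := by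
    intro Y r' hr' hY c; rw [one_mul]; exact hquad Y r' hr' hY c
  have hCd : DifferentiableOn ℂ C {Y : PBond P 0 → Matrix (Fin N) (Fin N) ℂ | ∀ b', w 1 b' * ‖Y b'‖ < Rs / 4} :=
    hdiff.sub Qlin.differentiable.differentiableOn
  have hHw : ∀ (X' : BondIdx D → Matrix (Fin N) (Fin N) ℂ) (t : ℝ), 0 ≤ t → (∀ c, (fun _ : BondIdx D => (1 : ℝ)) c * ‖X' c‖ ≤ t) →
      ∀ b', w 1 b' * ‖H X' b'‖ ≤ B₀ * t := by
    intro X' t ht hX' b'; exact hHB X' t ht (fun c => by simpa only [one_mul] using hX' c) b'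
  have hDball' : ∀ A'' : PBond P 0 → Matrix (Fin N) (Fin N) ℂ, (∀ b', w 1 b' * ‖A'' b'‖ < ε) →
      ∀ c, (fun _ : BondIdx D => (1 : ℝ)) c * ‖Dsel A'' c‖ ≤ 4 * C₂ * ε ^ 2 := by
    intro A'' hA'' c
    -- a size `ρ₀ < ε` of `A″` exists (finite max); the sharp bound at `ρ₀` is `≤ 4C₂ε²`
    obtain ⟨b₁, -, hmax⟩ := Finset.exists_max_image Finset.univ (fun b' : PBond P 0 => w 1 b' * ‖A'' b'‖) ⟨b₀, Finset.mem_univ _⟩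
    have hρ₀ : 0 ≤ w 1 b₁ * ‖A'' b₁‖ := mul_nonneg (hw1pos b₁).le (norm_nonneg _)
    have h := hDsharp A'' hA'' (w 1 b₁ * ‖A'' b₁‖) hρ₀ (fun b' => hmax b' (Finset.mem_univ b')) c
    rw [one_mul]
    refine h.trans ?_
    have : (w 1 b₁ * ‖A'' b₁‖) ^ 2 ≤ ε ^ 2 := pow_le_pow_left₀ hρ₀ (hA'' b₁).le 2
    exact mul_le_mul_of_nonneg_left this (by positivity)
  have hDfix' : ∀ A'' : PBond P 0 → Matrix (Fin N) (Fin N) ℂ, (∀ b', w 1 b' * ‖A'' b'‖ < ε) → C (A'' - H (Dsel A'')) = Dsel A'' :=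
    fun A'' hA'' => hDfix A'' hA''
  -- (1) the derivative of `Dsel` at `A′` and the implicit differentiation of (49)♭
  have hDer : HasFDerivAt Dsel (fderiv ℂ Dsel A') A' :=
    hasFDerivAt_chart47W_of_size_le (w₀ := w 1) (wB := fun _ => (1 : ℝ)) hw1pos (fun _ => one_pos) C H hC₂0 hB₀ hHw hCq hCd hq h3ε hε
      Dsel hDball' hDfix' A' r hr h0
  have hfixnhd : ∀ᶠ Y in 𝓝 A', Dsel Y = C (Y - H (Dsel Y)) :=
    eventually_fix_of_size_le (w₀ := w 1) (ε := ε) C H Dsel hDfix' A' r hr h0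
  have hCdiff : DifferentiableAt ℂ C (A' - H (Dsel A')) :=
    differentiableAt_shift_of_size_le (w₀ := w 1) (wB := fun _ => (1 : ℝ)) hw1pos C H hC₂0 hHw hCd hq h3ε hε Dsel hDball' A' r hr h0
  set Φ : PBond P 0 → Matrix (Fin N) (Fin N) ℂ := A' - H (Dsel A') with hΦ
  set C' : (PBond P 0 → Matrix (Fin N) (Fin N) ℂ) →L[ℂ] (BondIdx D → Matrix (Fin N) (Fin N) ℂ) := fderiv ℂ C Φ with hC'
  set 𝔇 : (PBond P 0 → Matrix (Fin N) (Fin N) ℂ) →L[ℂ] (BondIdx D → Matrix (Fin N) (Fin N) ℂ) := fderiv ℂ Dsel A' with h𝔇def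
  have hcomp : HasFDerivAt (fun Y => C (Y - H (Dsel Y))) (C'.comp ((ContinuousLinearMap.id ℂ _) - Hc.comp 𝔇)) A' := by
    have hin : HasFDerivAt (fun Y : PBond P 0 → Matrix (Fin N) (Fin N) ℂ => Y - H (Dsel Y)) ((ContinuousLinearMap.id ℂ _) - Hc.comp 𝔇) A' := by
      have h1 : HasFDerivAt (fun Y : PBond P 0 → Matrix (Fin N) (Fin N) ℂ => Hc (Dsel Y)) (Hc.comp 𝔇) A' := Hc.hasFDerivAt.comp A' hDer
      exact (hasFDerivAt_id A').sub h1
    exact hCdiff.hasFDerivAt.comp A' hin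
  have h𝔇eq : 𝔇 = C'.comp ((ContinuousLinearMap.id ℂ _) - Hc.comp 𝔇) :=
    hDer.unique (hcomp.congr_of_eventuallyEq hfixnhd)
  have h𝔇 : ∀ δ, 𝔇 δ = C' (δ - H (𝔇 δ)) := fun δ => by
    conv_lhs => rw [h𝔇eq]
    rfl
  -- (2) the two sizes of the dressed point are `≤ 2r`
  have hDr : ∀ c, ‖Dsel A' c‖ ≤ 4 * C₂ * r ^ 2 := fun c => hDsharp A' hA'ε r hr0 h0 c
  have hsmall : B₀ * (4 * C₂ * r ^ 2) ≤ r := by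
    have h1 : C₂ * B₀ * r ≤ C₂ * B₀ * ε := mul_le_mul_of_nonneg_left hr.le (by positivity)
    have h2 : 9 * (C₂ * B₀ * ε) < 1 := by linarith
    nlinarith
  have hHD1 : ∀ b', w 1 b' * ‖H (Dsel A') b'‖ ≤ B₀ * (4 * C₂ * r ^ 2) := hHB _ _ (by positivity) hDr
  have hHD2 : ∀ (b' : PBond P 0) (ν : Fin P.d), w 2 b' * (P.L : ℝ) ^ k * ‖H (Dsel A') ⟨b'.src.shift ν, b'.dir⟩ - H (Dsel A') b'‖ ≤ B₀ * (4 * C₂ * r ^ 2) :=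
    hHgrad _ _ (by positivity) hDr
  have hΦ1 : ∀ b', w 1 b' * ‖Φ b'‖ ≤ 2 * r := by
    intro b'
    have hsub : Φ b' = A' b' - H (Dsel A') b' := rfl
    calc w 1 b' * ‖Φ b'‖ ≤ w 1 b' * (‖A' b'‖ + ‖H (Dsel A') b'‖) := by
          rw [hsub]; exact mul_le_mul_of_nonneg_left (norm_sub_le _ _) (hw1pos b').le
      _ = w 1 b' * ‖A' b'‖ + w 1 b' * ‖H (Dsel A') b'‖ := mul_add _ _ _
      _ ≤ r + r := add_le_add (h0 b') ((hHD1 b').trans hsmall)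
      _ = 2 * r := by ring
  have hΦ2 : ∀ (b' : PBond P 0) (ν : Fin P.d), w 2 b' * (P.L : ℝ) ^ k * ‖Φ ⟨b'.src.shift ν, b'.dir⟩ - Φ b'‖ ≤ 2 * r := by
    intro b' ν
    have hsub : Φ ⟨b'.src.shift ν, b'.dir⟩ - Φ b' = (A' ⟨b'.src.shift ν, b'.dir⟩ - A' b') - (H (Dsel A') ⟨b'.src.shift ν, b'.dir⟩ - H (Dsel A') b') := by
      simp only [hΦ, Pi.sub_apply]; abel
    have hw2L : 0 ≤ w 2 b' * (P.L : ℝ) ^ k := mul_nonneg (hw2nn b') (by positivity)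
    calc w 2 b' * (P.L : ℝ) ^ k * ‖Φ ⟨b'.src.shift ν, b'.dir⟩ - Φ b'‖
        ≤ w 2 b' * (P.L : ℝ) ^ k * (‖A' ⟨b'.src.shift ν, b'.dir⟩ - A' b'‖ + ‖H (Dsel A') ⟨b'.src.shift ν, b'.dir⟩ - H (Dsel A') b'‖) := by
          rw [hsub]; exact mul_le_mul_of_nonneg_left (norm_sub_le _ _) hw2L
      _ ≤ r + r := by rw [mul_add]; exact add_le_add (h1 b' ν) ((hHD2 b' ν).trans hsmall)
      _ = 2 * r := by ring
  -- (3) transposes of `C♭′` (every base point), by formula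
  have hLne : (P.L : ℝ) ≠ 0 := hL0.ne'
  obtain ⟨-, -, Ct, -, -, hCt, -, -, -, -⟩ := exists_capstoneTransposes (β := BondIdx D) k hLne τ ρ hρ BE hBE B hB
    (0 : (PBond P 0 → Matrix (Fin N) (Fin N) ℂ) →L[ℂ] (BondIdx D → Matrix (Fin N) (Fin N) ℂ)) Hc (fun A'' => fderiv ℂ C A'')
  -- (4) p628026 at the dressed point: the letter of `Ct Φ`, radius `2r < 2ε`
  have hCtL : ∀ (X' : BondIdx D → Matrix (Fin N) (Fin N) ℂ) (s' : ℝ), (∀ i, (1 : ℝ) * ‖X' i‖ ≤ s') → ∀ b', w 3 b' * ‖Ct Φ X' b'‖ ≤ Θ₀ * (2 * r) * s' :=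
    h73t_flat_P (n := Fin N) hd k D hDk hAdm hRM hw τ ρ hρ hτ hτ1 hMρ hρn BE hBE B hB Ct hCt hwin1 hwin2 hwin3 hwin4 Φ (2 * r) hΦ1 hΦ2 (by linarith)
  -- (5) assemble (β1)'s `himp`
  refine ⟨C', Ct Φ, h𝔇, hCt Φ, fun X s hX b => ?_⟩
  have h := hCtL X s hX b
  calc w 3 b * ‖Ct Φ X b‖ ≤ Θ₀ * (2 * r) * s := h
    _ = 2 * Θ₀ * r * s := by ring

end Generic


end Summit.QuantumFields.YangMills.Theorems.K0Stub1FlatChartDTransposeLetter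

end
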